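import Summits.RiemannHypothesis.RiemannHypothesis.Theorems.PfPersistenceHalfLineBiasDictionary
import Summits.RiemannHypothesis.RiemannHypothesis.Theorems.PfPersistenceDilatingLandauWeightedConverse
import HarnessLib

/-!
# LANDAU for the half-line Chebyshev bias `B(x)` — IV: the converse under RH and the `ε`-equivalences

Cell `pub-rhpf` (mechanism/rigidity campaign; **no RH claims**), CAND SEAT 7 gen 8, CASE-DAG v6 §6
kernel target LANDAU, half-line bias `B(x) = Σ_{n ≤ x} Λ(n) n^{-1/2} log(x/n) − 4√x`
(`hlb = chebyshevHalfLineBias`, Suzuki 2024), file 4: the RH ⇒ side at power scale. Since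
`R(x) = ∫_1^x S(t) dt/t` (`wR_eq_integral`, FTC through the right derivative `R' = S/x`),
`B(x) + 4 = ∫_1^x (S(t) − 2√t) dt/t`, so the weighted converse
`PfPersistenceDilatingLandauWeightedConverse.abs_wpsiErr_le_rpow_of_riemannHypothesis` gives, under RH,
`|B(x)| ≤ x^ε` for all large `x`, every `ε > 0` (`abs_hlb_le_rpow_of_riemannHypothesis`). With file 3:
RH ⟺ (∀ ε > 0, `B(x) ≤ x^ε` eventually) ⟺ (∀ ε > 0, `−x^ε ≤ B(x)` eventually)
(`riemannHypothesis_iff_hlb_upper_eps` / `riemannHypothesis_iff_hlb_lower_eps`), and the trichotomy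
`hlb_oneSided_trichotomy`. (Suzuki's sharper RH ⇒ `B(x) ≤ 0` / `B(x) → −∞`, Thm. 1 (i)⇒(ii),(iii),
is obtained differently — from the screw function — in `PfPersistenceHalfLineBiasScrew`.) Sorry-free.

References: [Suzuki2024] M. Suzuki, arXiv:2411.07436, Thm. 1; [MontgomeryVaughan2007] Thm. 13.1, §15.1.
-/

noncomputable section

-- the sub-problem path RiemannHypothesis/RiemannHypothesis duplicates a namespace (D-0017)
set_option linter.dupNamespace false

open Filter Topology Set MeasureTheory

namespace Summit.RiemannHypothesis.RiemannHypothesis.Theorems.PfPersistenceHalfLineBiasConverse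

open Literature.NumberTheory.LFunctions
open Summit.RiemannHypothesis.RiemannHypothesis.Theorems.PfPersistenceDilatingLandauWeightedMellin
open Summit.RiemannHypothesis.RiemannHypothesis.Theorems.PfPersistenceDilatingLandauWeightedConverse
open Summit.RiemannHypothesis.RiemannHypothesis.Theorems.PfPersistenceDilatingLandauWeightedAbel
open Summit.RiemannHypothesis.RiemannHypothesis.Theorems.PfPersistenceHalfLineBiasMellin
open Summit.RiemannHypothesis.RiemannHypothesis.Theorems.PfPersistenceHalfLineBiasDictionary

/-! ## §6 `R(x) = ∫_1^x S(t) dt/t` -/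

/-- A measurable `g` with `|g| ≤ K` on `(1, x]` gives an interval-integrable `g(t)/t` on `[1, x]`.
[folklore] -/
theorem intervalIntegrable_div_of_bdd {g : ℝ → ℝ} (hg : Measurable g) {x K : ℝ} (hx : 1 ≤ x)
    (hK : ∀ t ∈ Ioc 1 x, |g t| ≤ K) :
    IntervalIntegrable (fun t : ℝ ↦ g t / t) volume 1 x := by
  rw [intervalIntegrable_iff_integrableOn_Ioc_of_le hx]
  refine (integrableOn_rpow_mul_of_bdd hg (a := -1) hK).congr_fun (fun t ht ↦ ?_)
    measurableSet_Ioc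
  simp only [Real.rpow_neg_one]
  rw [inv_mul_eq_div]

/-- **`R(x) = ∫_1^x S(t) dt/t` for `x ≥ 1`** (FTC through the right derivative `R' = S/x`, `R(1) = 0`).
[cite: MontgomeryVaughan2007, §2.1, §5.1] -/
theorem wR_eq_integral {x : ℝ} (hx : 1 ≤ x) : wR x = ∫ t in (1 : ℝ)..x, wpsi t / t := by
  have hderiv : ∀ t ∈ Ioo 1 x, HasDerivWithinAt wR (wpsi t / t) (Ioi t) t := by
    intro t ht
    have ht0 : 0 < t := zero_lt_one.trans ht.1
    have h := LogRieszAbel.hasDerivWithinAt_logRiesz wcoef ht.1.le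
    refine h.congr_of_eventuallyEq ?_ (wR_eq ht0)
    exact eventually_of_mem self_mem_nhdsWithin fun u (hu : t < u) ↦ wR_eq (ht0.trans hu)
  have hcont : ContinuousOn wR (Icc 1 x) :=
    (LogRieszAbel.continuousOn_logRiesz wcoef x).congr fun t ht ↦ wR_eq (by linarith [ht.1])
  have hK : ∀ t ∈ Ioc 1 x, |wpsi t| ≤ (Real.log 4 + 4) * x := fun t ht ↦ by
    rw [abs_of_nonneg (wpsi_nonneg t)]
    have := wpsi_le t (by linarith [ht.1])
    nlinarith [ht.2, Real.log_nonneg (by norm_num : (1 : ℝ) ≤ 4)]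
  have hint := intervalIntegrable_div_of_bdd measurable_wpsi hx hK
  have hR1 : wR 1 = 0 := by simp [wR, wT]
  rw [intervalIntegral.integral_eq_sub_of_hasDeriv_right_of_le hx hcont hderiv hint, hR1, sub_zero]

/-- **`B(x) + 4 = ∫_1^x (S(t) − 2√t) dt/t` for `x ≥ 1`.** [cite: Suzuki2024, §2; MontgomeryVaughan2007, §5.1] -/
theorem hlb_eq_integral {x : ℝ} (hx : 1 ≤ x) :
    hlb x = (∫ t in (1 : ℝ)..x, wpsiErr t / t) - 4 := by
  have hx0 : 0 < x := by linarith
  have h0u : (0 : ℝ) ∉ Set.uIcc 1 x := by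
    rw [Set.uIcc_of_le hx]; intro h; linarith [h.1]
  have hcpow : ContinuousOn (fun t : ℝ ↦ 2 * t ^ (-(1 / 2 : ℝ))) (Set.uIcc 1 x) := by
    rw [Set.uIcc_of_le hx]
    exact continuousOn_const.mul
      (ContinuousOn.rpow_const (by fun_prop) fun t ht ↦ Or.inl (by linarith [ht.1] : t ≠ 0))
  have hiP : IntervalIntegrable (fun t : ℝ ↦ 2 * t ^ (-(1 / 2 : ℝ))) volume 1 x :=
    hcpow.intervalIntegrable
  have hKE : ∀ t ∈ Ioc 1 x, |wpsiErr t| ≤ (Real.log 4 + 6) * x := fun t ht ↦ by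
    have ht0 : 0 ≤ t := by linarith [ht.1]
    have h1 := wpsi_le t ht0
    have h2 := wpsi_nonneg t
    have h3 : t ^ (1 / 2 : ℝ) ≤ t := by
      calc t ^ (1 / 2 : ℝ) ≤ t ^ (1 : ℝ) := Real.rpow_le_rpow_of_exponent_le ht.1.le (by norm_num)
        _ = t := Real.rpow_one t
    have h4 : 0 ≤ t ^ (1 / 2 : ℝ) := Real.rpow_nonneg ht0 _
    rw [wpsiErr, abs_le]
    constructor <;> nlinarith [ht.2, Real.log_nonneg (by norm_num : (1 : ℝ) ≤ 4)]
  have hiE := intervalIntegrable_div_of_bdd measurable_wpsiErr hx hKE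
  -- `S(t)/t = (S(t) − 2√t)/t + 2 t^{-1/2}` on `(1, x]`
  have hsplit : ∫ t in (1 : ℝ)..x, wpsi t / t =
      (∫ t in (1 : ℝ)..x, wpsiErr t / t) + ∫ t in (1 : ℝ)..x, 2 * t ^ (-(1 / 2 : ℝ)) := by
    rw [← intervalIntegral.integral_add hiE hiP]
    · refine intervalIntegral.integral_congr fun t ht ↦ ?_
      rw [Set.uIcc_of_le hx] at ht
      have ht0 : 0 < t := by linarith [ht.1]
      have hh : t ^ (-(1 / 2 : ℝ)) * t = t ^ (1 / 2 : ℝ) := by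
        calc t ^ (-(1 / 2 : ℝ)) * t = t ^ (-(1 / 2 : ℝ)) * t ^ (1 : ℝ) := by rw [Real.rpow_one]
          _ = t ^ (1 / 2 : ℝ) := by rw [← Real.rpow_add ht0]; norm_num
      simp only [wpsiErr]
      field_simp
      rw [← hh]
      ring
  have hP : ∫ t in (1 : ℝ)..x, 2 * t ^ (-(1 / 2 : ℝ)) = 4 * x ^ (1 / 2 : ℝ) - 4 := by
    rw [intervalIntegral.integral_const_mul, integral_rpow (Or.inl (by norm_num)), Real.one_rpow]
    norm_num
    ring
  rw [hlb, wR_eq_integral hx, hsplit, hP]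
  ring

/-! ## §7 RH ⇒ `B(x) = O(x^ε)` -/

/-- **Under RH, `|B(x)| ≤ x^ε` for all large `x`, for every `ε > 0`** (from the weighted converse
through `B + 4 = ∫_1^x (S − 2√t) dt/t`). [cite: Suzuki2024, Thm. 1; MontgomeryVaughan2007, Thm. 13.1] -/
theorem abs_hlb_le_rpow_of_riemannHypothesis (hRH : RiemannHypothesis) {ε : ℝ} (hε : 0 < ε) :
    ∀ᶠ x in atTop, |hlb x| ≤ x ^ ε := by
  have hδ : 0 < ε / 2 := by linarith
  obtain ⟨T₀, hT₀⟩ := eventually_atTop.1 (abs_wpsiErr_le_rpow_of_riemannHypothesis hRH hδ)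
  set T : ℝ := max T₀ 1 with hTdef
  have hT1 : 1 ≤ T := le_max_right _ _
  have hE : ∀ t, T ≤ t → |wpsiErr t| ≤ t ^ (ε / 2) := fun t ht ↦ hT₀ t ((le_max_left _ _).trans ht)
  have hl4 : 0 ≤ Real.log 4 := Real.log_nonneg (by norm_num)
  set M : ℝ := (Real.log 4 + 6) * T with hMdef
  have hM0 : 0 ≤ M := by positivity
  -- `|S(t) − 2√t| ≤ (log 4 + 6) t` for `t ≥ 1`
  have hcrude : ∀ t : ℝ, 1 ≤ t → |wpsiErr t| ≤ (Real.log 4 + 6) * t := by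
    intro t ht
    have ht0 : 0 ≤ t := by linarith
    have h1 := wpsi_le t ht0
    have h2 := wpsi_nonneg t
    have h3 : t ^ (1 / 2 : ℝ) ≤ t := by
      calc t ^ (1 / 2 : ℝ) ≤ t ^ (1 : ℝ) := Real.rpow_le_rpow_of_exponent_le ht (by norm_num)
        _ = t := Real.rpow_one t
    have h4 : 0 ≤ t ^ (1 / 2 : ℝ) := Real.rpow_nonneg ht0 _
    rw [wpsiErr, abs_le]
    constructor <;> nlinarith
  -- pointwise bound `|E_S(t)/t| ≤ M t⁻¹ + t^{-1+ε/2}` on `(1, ∞)`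
  have hpt : ∀ t : ℝ, 1 < t → |wpsiErr t / t| ≤ M * t⁻¹ + t ^ (-1 + ε / 2) := by
    intro t ht
    have ht0 : 0 < t := by linarith
    have hq : 0 < t ^ (-1 + ε / 2) := Real.rpow_pos_of_pos ht0 _
    have hi : 0 < t⁻¹ := inv_pos.2 ht0
    rw [abs_div, abs_of_pos ht0, div_eq_mul_inv]
    rcases le_or_gt T t with hTt | htT
    · have h1 : |wpsiErr t| * t⁻¹ ≤ t ^ (-1 + ε / 2) := by
        calc |wpsiErr t| * t⁻¹ ≤ t ^ (ε / 2) * t⁻¹ := mul_le_mul_of_nonneg_right (hE t hTt) hi.le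
          _ = t ^ (-1 + ε / 2) := by
              rw [← Real.rpow_neg_one, ← Real.rpow_add ht0]; congr 1; ring
      nlinarith [mul_nonneg hM0 hi.le]
    · have h2 : |wpsiErr t| ≤ M := by
        refine (hcrude t ht.le).trans ?_
        rw [hMdef]
        exact mul_le_mul_of_nonneg_left htT.le (by positivity)
      have h1 : |wpsiErr t| * t⁻¹ ≤ M * t⁻¹ := mul_le_mul_of_nonneg_right h2 hi.le
      linarith
  have hy : Tendsto (fun x : ℝ ↦ x ^ (ε / 2)) atTop atTop := tendsto_rpow_atTop hδ
  filter_upwards [eventually_ge_atTop T, hy.eventually_ge_atTop (4 / ε * (M + 1)),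
    hy.eventually_ge_atTop 3] with x hxT hy1 hy2
  have hx1 : 1 ≤ x := hT1.trans hxT
  have hx0 : 0 < x := by linarith
  have h0u : (0 : ℝ) ∉ Set.uIcc 1 x := by
    rw [Set.uIcc_of_le hx1]; intro h; linarith [h.1]
  -- interval integrability of the dominating function and of `E_S(t)/t`
  have hcg : ContinuousOn (fun t : ℝ ↦ M * t⁻¹ + t ^ (-1 + ε / 2)) (Set.uIcc 1 x) := by
    rw [Set.uIcc_of_le hx1]
    refine (continuousOn_const.mul (continuousOn_inv₀.mono fun t ht ↦ ?_)).add
      (ContinuousOn.rpow_const (by fun_prop) fun t ht ↦ Or.inl (by linarith [ht.1] : t ≠ 0))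
    exact (by linarith [ht.1] : t ≠ 0)
  have hig : IntervalIntegrable (fun t : ℝ ↦ M * t⁻¹ + t ^ (-1 + ε / 2)) volume 1 x :=
    hcg.intervalIntegrable
  have hi1 : IntervalIntegrable (fun t : ℝ ↦ M * t⁻¹) volume 1 x := by
    refine ContinuousOn.intervalIntegrable ?_
    rw [Set.uIcc_of_le hx1]
    exact continuousOn_const.mul (continuousOn_inv₀.mono fun t ht ↦ (by linarith [ht.1] : t ≠ 0))
  have hi2 : IntervalIntegrable (fun t : ℝ ↦ t ^ (-1 + ε / 2)) volume 1 x := by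
    refine ContinuousOn.intervalIntegrable ?_
    rw [Set.uIcc_of_le hx1]
    exact ContinuousOn.rpow_const (by fun_prop) fun t ht ↦ Or.inl (by linarith [ht.1] : t ≠ 0)
  -- `∫_1^x (M t⁻¹ + t^{-1+ε/2}) dt = M log x + (x^{ε/2} − 1)/(ε/2) ≤ (2/ε)(M + 1) x^{ε/2}`
  have hdom : ∫ t in (1 : ℝ)..x, (M * t⁻¹ + t ^ (-1 + ε / 2)) ≤ 2 / ε * (M + 1) * x ^ (ε / 2) := by
    rw [intervalIntegral.integral_add hi1 hi2, intervalIntegral.integral_const_mul,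
      integral_inv_of_pos one_pos hx0, div_one, integral_rpow (Or.inl (by linarith)), Real.one_rpow]
    have e2 : (-1 + ε / 2) + 1 = ε / 2 := by ring
    rw [e2]
    have hlog : Real.log x ≤ x ^ (ε / 2) / (ε / 2) := Real.log_le_rpow_div hx0.le hδ
    have hA : M * Real.log x ≤ M * (2 / ε * x ^ (ε / 2)) := by
      refine mul_le_mul_of_nonneg_left (hlog.trans_eq ?_) hM0
      field_simp
    have hB : (x ^ (ε / 2) - 1) / (ε / 2) ≤ 2 / ε * x ^ (ε / 2) := by
      rw [div_le_iff₀ hδ]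
      have : 2 / ε * x ^ (ε / 2) * (ε / 2) = x ^ (ε / 2) := by field_simp
      rw [this]; linarith
    have : 2 / ε * (M + 1) * x ^ (ε / 2) = M * (2 / ε * x ^ (ε / 2)) + 2 / ε * x ^ (ε / 2) := by ring
    rw [this]
    linarith
  have herr : |∫ t in (1 : ℝ)..x, wpsiErr t / t| ≤ 2 / ε * (M + 1) * x ^ (ε / 2) := by
    refine le_trans ?_ hdom
    have h := intervalIntegral.norm_integral_le_of_norm_le (f := fun t : ℝ ↦ wpsiErr t / t) hx1
      (Eventually.of_forall fun t ht ↦ by rw [Real.norm_eq_abs]; exact hpt t ht.1) hig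
    simpa only [Real.norm_eq_abs] using h
  -- conclusion
  have hsq : x ^ ε = x ^ (ε / 2) * x ^ (ε / 2) := by rw [← Real.rpow_add hx0]; ring_nf
  rw [hlb_eq_integral hx1, hsq]
  set y : ℝ := x ^ (ε / 2) with hydef
  set I : ℝ := ∫ t in (1 : ℝ)..x, wpsiErr t / t with hIdef
  have hy0 : 0 ≤ y := by positivity
  have hε' : 0 < 4 / ε := by positivity
  have h1' : 2 / ε * (M + 1) * y ≤ y * y / 2 := by
    have : 2 / ε * (M + 1) = (4 / ε * (M + 1)) / 2 := by ring
    rw [this]; nlinarith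
  have h2' : (4 : ℝ) ≤ y * y / 2 := by nlinarith
  calc |I - 4| ≤ |I| + |(4 : ℝ)| := abs_sub _ _
    _ ≤ 2 / ε * (M + 1) * y + 4 := by rw [abs_of_pos (by norm_num : (0:ℝ) < 4)]; linarith
    _ ≤ y * y := by linarith

/-! ## §8 The one-sided `ε`-equivalences for `B` -/

/-- **One-sided `x^ε` bounds on `B` for every `ε > 0` ⇒ RH** (either sign).
[cite: MontgomeryVaughan2007, Thm. 15.3 (double-pole kernel); Suzuki2024, Thm. 1] -/
theorem riemannHypothesis_of_hlb_oneSided_eps {η : ℝ} (hη : η = 1 ∨ η = -1)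
    (h : ∀ ε : ℝ, 0 < ε → ∀ᶠ x in atTop, η * hlb x ≤ x ^ ε) : RiemannHypothesis := by
  refine quasiRiemannHypothesis_one_half_iff_holds.mp fun s hs h1 _h2 ↦ ?_
  have hε : 0 < (s.re - 1 / 2) / 2 := by linarith
  have hev : ∀ᶠ x in atTop, η * hlb x ≤ 1 * x ^ ((s.re - 1 / 2) / 2) := by
    simpa only [one_mul] using h _ hε
  have := re_le_of_hlb_oneSided hη hε.le hev hs
  linarith

/-- **RH ⟺ (∀ ε > 0, `B(x) ≤ x^ε` for all large `x`).** [cite: Suzuki2024, Thm. 1; MontgomeryVaughan2007, Thm. 15.3] -/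
theorem riemannHypothesis_iff_hlb_upper_eps :
    RiemannHypothesis ↔ ∀ ε : ℝ, 0 < ε → ∀ᶠ x in atTop, hlb x ≤ x ^ ε := by
  constructor
  · intro hRH ε hε
    filter_upwards [abs_hlb_le_rpow_of_riemannHypothesis hRH hε] with x hx
    exact (le_abs_self _).trans hx
  · intro h
    refine riemannHypothesis_of_hlb_oneSided_eps (η := 1) (Or.inl rfl) fun ε hε ↦ ?_
    filter_upwards [h ε hε] with x hx
    rwa [one_mul]

/-- **RH ⟺ (∀ ε > 0, `−x^ε ≤ B(x)` for all large `x`).** [cite: Suzuki2024, Thm. 1; MontgomeryVaughan2007, Thm. 15.3] -/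
theorem riemannHypothesis_iff_hlb_lower_eps :
    RiemannHypothesis ↔ ∀ ε : ℝ, 0 < ε → ∀ᶠ x in atTop, -x ^ ε ≤ hlb x := by
  constructor
  · intro hRH ε hε
    filter_upwards [abs_hlb_le_rpow_of_riemannHypothesis hRH hε] with x hx
    exact (abs_le.1 hx).1
  · intro h
    refine riemannHypothesis_of_hlb_oneSided_eps (η := -1) (Or.inr rfl) fun ε hε ↦ ?_
    filter_upwards [h ε hε] with x hx
    linarith

/-- **RH ⟺ (∀ ε > 0, `chebyshevHalfLineBias x ≤ x^ε` for all large `x`)**, Suzuki's bias in the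
Literature normalisation. [cite: Suzuki2024, Thm. 1; MontgomeryVaughan2007, Thm. 15.3] -/
theorem riemannHypothesis_iff_chebyshevHalfLineBias_upper_eps :
    RiemannHypothesis ↔ ∀ ε : ℝ, 0 < ε → ∀ᶠ x in atTop, chebyshevHalfLineBias x ≤ x ^ ε := by
  rw [riemannHypothesis_iff_hlb_upper_eps]
  refine forall₂_congr fun ε _ ↦ ?_
  constructor <;> intro h <;> filter_upwards [h, eventually_gt_atTop 0] with x hx hx0
  · rwa [← hlb_eq_chebyshevHalfLineBias hx0]
  · rwa [hlb_eq_chebyshevHalfLineBias hx0]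

/-- **The trichotomy for one-sided power-scale readers of `B`** (`η = ±1`):
(a) for every `τ ≥ 0`, `η B ≤ A x^τ` eventually ⇒ quasi-RH(1/2 + τ);
(b) RH ⟺ (∀ ε > 0, `η B ≤ x^ε` eventually);
(c) `τ = 0`: a one-sided `O(1)` bound ⇒ RH.
[cite: Suzuki2024, Thm. 1; MontgomeryVaughan2007, Thm. 15.3] -/
theorem hlb_oneSided_trichotomy {η : ℝ} (hη : η = 1 ∨ η = -1) :
    (∀ A τ : ℝ, 0 ≤ τ → (∀ᶠ x in atTop, η * hlb x ≤ A * x ^ τ) →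
        QuasiRiemannHypothesis (1 / 2 + τ)) ∧
      (RiemannHypothesis ↔ ∀ ε : ℝ, 0 < ε → ∀ᶠ x in atTop, η * hlb x ≤ x ^ ε) ∧
      (∀ A : ℝ, (∀ᶠ x in atTop, η * hlb x ≤ A) → RiemannHypothesis) := by
  refine ⟨fun A τ hτ hev ↦ quasiRiemannHypothesis_of_hlb_oneSided hη hτ hev, ?_,
    fun A hev ↦ riemannHypothesis_of_hlb_oneSided_bdd hη hev⟩
  constructor
  · intro hRH ε hε
    filter_upwards [abs_hlb_le_rpow_of_riemannHypothesis hRH hε] with x hx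
    rcases hη with rfl | rfl
    · rw [one_mul]; exact (le_abs_self _).trans hx
    · have := (abs_le.1 hx).1; linarith
  · exact riemannHypothesis_of_hlb_oneSided_eps hη

end Summit.RiemannHypothesis.RiemannHypothesis.Theorems.PfPersistenceHalfLineBiasConverse

end
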